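import Summits.HodgeConjecture.CorCM.GaloisThirtyTwoTimesPrimeStructure
import Summits.HodgeConjecture.CorCM.GaloisNonNormalPrimeOrderOrbits
import Summits.HodgeConjecture.CorCM.GaloisNormalSylow
import HarnessLib

/-!
# DEGREE `32·p` FOR EVERY ODD PRIME `p`: the Sylow `p`-subgroup of a GOOD field is NORMAL, complex conjugation is the UNIQUE
# involution, and `Gal = C_p ⋊ C₃₂` or `C_p ⋊ Q₃₂` in one of the FIVE SHAPES — no exception, no size hypothesis

COR-CM (cell `pub-hodgecm2`), binder seat b04 (gen 39), count-neutral own lane «Galois-CM-type classification».  KERNEL ONLY: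
theorems; no definition, no named fact, no `sorry`.  `HC_CM` is neither used nor claimed.

Gen 38 (`CorCM/GaloisThirtyTwoTimesPrimeStructure`) proved the five-shapes theorem at degree `32·p` for every odd prime `p ∉ {5, 7}`:
`p = 3` by gen 33's count, `p ∈ {11, …, 29}` by Sylow counting (no divisor `d ≠ 1` of `32` is `≡ 1 (mod p)`), `p ≥ 31` by
`CorCM/GaloisNormalSylow`.  The two exceptions were exactly the primes with a divisor of `32` congruent to `1` (`16 ≡ 1 (5)`, `8 ≡ 1 (7)`)
AND below gen 33's counting threshold (`|G| = 160 < 170`, `224 < 238`).  The refined count of gen 39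
(`CorCM/GaloisSkewSectionPrimeOrbits`, `CorCM/GaloisNonNormalPrimeOrderOrbits`: thresholds `150` for `p = 5`, `210` for `p = 7`) closes
both, so that now, for a GOOD Galois CM field `K` of degree `32·p`, `p` ANY odd prime:

* **`sylow_normal_thirtytwo_mul_prime`** — every Sylow `p`-subgroup of `Gal(K/ℚ)` is normal (order `p`);
* **`involution_eq_complexConj_thirtytwo_mul_prime`** — complex conjugation is the unique involution of `Gal(K/ℚ)`;
* `sylow_two_isCyclic_or_quaternion_thirtytwo_mul_prime` — the Sylow `2`-subgroups are `C₃₂` or `Q₃₂`;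
* **`shapes_thirtytwo_mul_prime'`** — `Gal(K/ℚ) = ⟨u⟩ ⋊ S` in shape C(r) (`S = ⟨x⟩ ≅ C₃₂`, `x u x⁻¹ = uʳ`) or with `S = ⟨a, x⟩ ≅ Q₃₂`
  acting through `±1` in one of the three ways Q×, Dic, QK (gen 38's `shapes_thirtytwo_mul_prime` without `p ≠ 5`, `p ≠ 7`);
* BAD corollaries (§3): at degree `32·p` an involution `σ ≠ c`, or a Sylow `2`-subgroup which is neither cyclic nor `≅ Q₃₂`, yields a
  SIMPLE DEGENERATE abelian variety of dimension `16p` with an exceptional Hodge class on some power — e.g. every Galois CM field with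
  group `(C₂⁴ ⋊ C₅) × C₂`, `2^{1+4}_- ⋊ C₅`, `(C₂³ ⋊ C₇) × C₄`, `D₁₆ × C_p × …` of these degrees.

With gen 37 (`[K:ℚ] = 32`: `Gal ∈ {C₃₂, Q₃₂, C₁₆ × C₂, Q₁₆ × C₂}`) the degree-`32·M` picture for `M ∈ {1} ∪ {odd primes}` is complete
and hypothesis-free; what remains at `n = 5` is the odd part `M` composite (gen 38's `odd_part_eq_one_or_prime'` under its size
condition) and, as everywhere, the arithmetic of the shapes C(r) (residue classes), Q×, QK.

## References

* [Rotman1995] J. J. Rotman, *An Introduction to the Theory of Groups*, 4th ed., GTM 148, Thm. 4.12 (Sylow), Thm. 5.46, Thm. 7.41.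
* [Shimura1998] G. Shimura, *Abelian Varieties with Complex Multiplication and Modular Functions*, §6.2 Thm. 3, §8.2 Prop. 26, §32.10.
* [Gordon1999HodgeAVSurvey] B. B. Gordon, *A survey of the Hodge conjecture for abelian varieties*, Thm. 6.4, §9.3.
* [Dodson1984] B. Dodson, *The structure of Galois groups of CM-fields*, Trans. AMS 283 (1984), §5.
-/

noncomputable section

open CategoryTheory CategoryTheory.Limits NumberField
open scoped BigOperators

namespace Summit.HodgeConjecture.CorCM.GaloisModels

open Literature.NumberTheory.ComplexMultiplication Literature.AlgebraicGeometry.HodgeTheory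
open Literature.AlgebraicGeometry.Motives (AbelianVariety CMType)
open Literature.AlgebraicGeometry.ComplexMultiplication (IsCMTypeRealisation)
open Literature.AlgebraicGeometry.Pohlmann1968 Summit.HodgeConjecture.CorCM.GaloisRank
open Literature.Barriers.HodgeConjecture (divisorClassesSpan)

/-! ## §1 A subgroup is normal as soon as conjugation acts on it by powers -/

/-- A subgroup `Q` such that every conjugate of every element of `Q` is a power of that element is normal. [folklore] -/
theorem normal_of_forall_conj_eq_pow {G : Type*} [Group G] (Q : Subgroup G)
    (h : ∀ u ∈ Q, ∀ g : G, ∃ k : ℕ, g * u * g⁻¹ = u ^ k) : Q.Normal :=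
  ⟨fun u hu g => by
    obtain ⟨k, hk⟩ := h u hu g
    rw [hk]
    exact Q.pow_mem hu k⟩

/-- An odd prime other than `3, 5, 7, 11, 13, 17, 19, 23, 29` is at least `31`. [folklore] -/
theorem thirtyone_le_of_prime {p : ℕ} (hp : p.Prime) (hp2 : p ≠ 2) (hsmall : ¬ (p = 3 ∨ p = 5 ∨ p = 7))
    (hmid : ¬ (p = 11 ∨ p = 13 ∨ p = 17 ∨ p = 19 ∨ p = 23 ∨ p = 29)) : 31 ≤ p := by
  by_contra h31
  have hlt : p < 31 := by omega
  interval_cases p <;> first | omega | exact absurd hp (by norm_num)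

variable {K : Type} [Field K] [NumberField K] [IsCMField K] [IsGalois ℚ K]

/-! ## §2 Degree `32·p`: the Sylow `p`-subgroup is normal, for every odd prime `p` -/

/-- **DEGREE `32·p`, `p` ANY ODD PRIME: the Sylow `p`-subgroups of the Galois group of a GOOD field are NORMAL.**  `p ∈ {3, 5, 7}`: a
non-normal `⟨u⟩` of order `p` would make `K` BAD by the refined skew-section count (`|Gal| = 96 ≥ 78`, `160 ≥ 150`, `224 ≥ 210`);
`p ∈ {11, …, 29}`: Sylow counting; `p ≥ 31`: `CorCM/GaloisNormalSylow`. [cite: Rotman1995, Thm. 4.12] [cite: Shimura1998, §8.2 Prop. 26 and §32.10] -/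
theorem sylow_normal_thirtytwo_mul_prime {p : ℕ} [hp : Fact p.Prime] (hp2 : p ≠ 2) (hdeg : Module.finrank ℚ K = 32 * p)
    (hgood : ∀ (Φ : CMType K) (φ : K →+* ℂ), IsPrimitive (ℂ ≃+* ℂ) Φ.1 φ → IsNondegenerate Φ)
    (Q : Sylow p (K ≃ₐ[ℚ] K)) : (Q : Subgroup (K ≃ₐ[ℚ] K)).Normal := by
  classical
  have hpp := hp.out
  have hdeg' : Module.finrank ℚ K = p ^ 1 * 2 ^ 5 := by rw [hdeg]; ring
  have hpr : ¬ p ∣ 2 ^ 5 := fun h => hp2 ((Nat.prime_dvd_prime_iff_eq hpp Nat.prime_two).1 (hpp.dvd_of_dvd_pow h))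
  obtain ⟨hcardQ, hidxQ⟩ := card_sylow_eq_of_finrank hdeg' hpr Q
  rw [pow_one] at hcardQ
  by_cases hsmall : p = 3 ∨ p = 5 ∨ p = 7
  · refine normal_of_forall_conj_eq_pow (Q : Subgroup (K ≃ₐ[ℚ] K)) fun u hu g => ?_
    by_cases hu1 : u = 1
    · exact ⟨1, by rw [hu1, mul_one, mul_inv_cancel, one_pow]⟩
    have hup : u ^ p = 1 := by
      have h : (⟨u, hu⟩ : (Q : Subgroup (K ≃ₐ[ℚ] K))) ^ Nat.card (Q : Subgroup (K ≃ₐ[ℚ] K)) = 1 := pow_card_eq_one'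
      rw [hcardQ] at h
      exact congrArg Subtype.val h
    have hcase : (p = 2 ∧ 44 ≤ Module.finrank ℚ K) ∨ (p = 3 ∧ 78 ≤ Module.finrank ℚ K) ∨ (p = 5 ∧ 150 ≤ Module.finrank ℚ K) ∨
        (p = 7 ∧ 210 ≤ Module.finrank ℚ K) := by
      rw [hdeg]
      rcases hsmall with rfl | rfl | rfl
      · exact Or.inr (Or.inl ⟨rfl, by norm_num⟩)
      · exact Or.inr (Or.inr (Or.inl ⟨rfl, by norm_num⟩))
      · exact Or.inr (Or.inr (Or.inr ⟨rfl, by norm_num⟩))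
    obtain ⟨k, -, hk⟩ := exists_conj_eq_pow_of_forall_isNondegenerate_of_card_ge p hcase hgood u hup hu1 g
    exact ⟨k, hk⟩
  by_cases hmid : p = 11 ∨ p = 13 ∨ p = 17 ∨ p = 19 ∨ p = 23 ∨ p = 29
  · exact sylow_normal_of_forall_dvd_index Q fun d hd hmod =>
      eq_one_of_dvd_thirtytwo_of_modEq hmid (by rw [← hidxQ]; exact hd) hmod
  · exact sylow_normal_of_forall_isNondegenerate_of_ge p (thirtyone_le_of_prime hpp hp2 hsmall hmid) hgood Q

/-- **Degree `32·p`, `p` any odd prime, `K` GOOD: a normal subgroup of order `p`.** [cite: Rotman1995, Thm. 4.12] [cite: Shimura1998, §8.2 Prop. 26 and §32.10] -/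
theorem exists_normal_prime_thirtytwo_mul_prime {p : ℕ} [hp : Fact p.Prime] (hp2 : p ≠ 2) (hdeg : Module.finrank ℚ K = 32 * p)
    (hgood : ∀ (Φ : CMType K) (φ : K →+* ℂ), IsPrimitive (ℂ ≃+* ℂ) Φ.1 φ → IsNondegenerate Φ) :
    ∃ P : Subgroup (K ≃ₐ[ℚ] K), P.Normal ∧ Nat.card P = p := by
  classical
  have hpp := hp.out
  obtain ⟨Q⟩ := (inferInstance : Nonempty (Sylow p (K ≃ₐ[ℚ] K)))
  have hdeg' : Module.finrank ℚ K = p ^ 1 * 2 ^ 5 := by rw [hdeg]; ring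
  have hpr : ¬ p ∣ 2 ^ 5 := fun h => hp2 ((Nat.prime_dvd_prime_iff_eq hpp Nat.prime_two).1 (hpp.dvd_of_dvd_pow h))
  obtain ⟨hcardQ, -⟩ := card_sylow_eq_of_finrank hdeg' hpr Q
  rw [pow_one] at hcardQ
  exact ⟨Q, sylow_normal_thirtytwo_mul_prime hp2 hdeg hgood Q, hcardQ⟩

/-- **DEGREE `32·p`, `p` ANY ODD PRIME: complex conjugation is the UNIQUE involution of the Galois group of a GOOD field.**
[cite: Shimura1998, §8.2 Prop. 26 and §32.10] [cite: Dodson1984, §5] [cite: Rotman1995, Thm. 5.46] -/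
theorem involution_eq_complexConj_thirtytwo_mul_prime {p : ℕ} [hp : Fact p.Prime] (hp2 : p ≠ 2)
    (hdeg : Module.finrank ℚ K = 32 * p)
    (hgood : ∀ (Φ : CMType K) (φ : K →+* ℂ), IsPrimitive (ℂ ≃+* ℂ) Φ.1 φ → IsNondegenerate Φ)
    (σ : K ≃ₐ[ℚ] K) (hσσ : σ * σ = 1) (hσ1 : σ ≠ 1) : σ = (IsCMField.complexConj K).restrictScalars ℚ := by
  obtain ⟨P, hPn, hcardP⟩ := exists_normal_prime_thirtytwo_mul_prime hp2 hdeg hgood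
  haveI := hPn
  exact involution_eq_complexConj_of_normal_prime hp2 (by rw [hdeg]; norm_num : Module.finrank ℚ K = 2 ^ 5 * p) le_rfl P hcardP
    hgood σ hσσ hσ1

/-- **DEGREE `32·p`, `p` ANY ODD PRIME: the Sylow `2`-subgroups of the Galois group of a GOOD field are cyclic or `≅ Q₃₂`.**
[cite: Rotman1995, Thm. 5.46] [cite: Shimura1998, §8.2 Prop. 26 and §32.10] -/
theorem sylow_two_isCyclic_or_quaternion_thirtytwo_mul_prime {p : ℕ} [hp : Fact p.Prime] (hp2 : p ≠ 2)
    (hdeg : Module.finrank ℚ K = 32 * p)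
    (hgood : ∀ (Φ : CMType K) (φ : K →+* ℂ), IsPrimitive (ℂ ≃+* ℂ) Φ.1 φ → IsNondegenerate Φ) [Fact (Nat.Prime 2)]
    (S : Sylow 2 (K ≃ₐ[ℚ] K)) :
    Nat.card (S : Subgroup (K ≃ₐ[ℚ] K)) = 2 ^ 5 ∧
      (IsCyclic (S : Subgroup (K ≃ₐ[ℚ] K)) ∨ Nonempty ((S : Subgroup (K ≃ₐ[ℚ] K)) ≃* QuaternionGroup (2 ^ (5 - 2)))) := by
  obtain ⟨P, hPn, hcardP⟩ := exists_normal_prime_thirtytwo_mul_prime hp2 hdeg hgood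
  haveI := hPn
  exact sylow_two_isCyclic_or_quaternion_of_normal_prime hp2 (by rw [hdeg]; norm_num : Module.finrank ℚ K = 2 ^ 5 * p) le_rfl P
    hcardP hgood S

/-- **DEGREE `32·p`, `p` ANY ODD PRIME: THE FIVE SHAPES, with no size hypothesis and no exception.**  If every primitive CM type of the
Galois CM field `K` of degree `32·p` is nondegenerate, then every Sylow `2`-subgroup `S` of `Gal(K/ℚ)` has order `32` and either `S = ⟨x⟩`
is cyclic and `Gal(K/ℚ) = ⟨u⟩ ⋊ ⟨x⟩` with `x u x⁻¹ = uʳ` (shape C(r)), or `S = ⟨a, x⟩ ≃ Q₃₂` acting on `⟨u⟩ ≅ C_p` through `±1` in one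
of the three ways Q×, Dic, QK. [cite: Rotman1995, Thm. 4.12, Thm. 5.46 and Thm. 7.41] [cite: Shimura1998, §8.2 Prop. 26 and §32.10] [cite: Dodson1984, §5] -/
theorem shapes_thirtytwo_mul_prime' {p : ℕ} [hp : Fact p.Prime] (hp2 : p ≠ 2) (hdeg : Module.finrank ℚ K = 32 * p)
    (hgood : ∀ (Φ : CMType K) (φ : K →+* ℂ), IsPrimitive (ℂ ≃+* ℂ) Φ.1 φ → IsNondegenerate Φ) [Fact (Nat.Prime 2)]
    (S : Sylow 2 (K ≃ₐ[ℚ] K)) : Nat.card (S : Subgroup (K ≃ₐ[ℚ] K)) = 2 ^ 5 ∧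
      ((IsCyclic (S : Subgroup (K ≃ₐ[ℚ] K)) ∧ ∃ u x : K ≃ₐ[ℚ] K, orderOf u = p ∧ (Subgroup.zpowers u).Normal ∧ orderOf x = 2 ^ 5 ∧
          Subgroup.zpowers x = (S : Subgroup (K ≃ₐ[ℚ] K)) ∧ (∀ g : K ≃ₐ[ℚ] K, ∃ j i : ℕ, g = u ^ j * x ^ i) ∧
          ∃ r : ℕ, x * u * x⁻¹ = u ^ r) ∨
       (Nonempty ((S : Subgroup (K ≃ₐ[ℚ] K)) ≃* QuaternionGroup (2 ^ (5 - 2))) ∧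
          ∃ u a x : K ≃ₐ[ℚ] K, orderOf u = p ∧ (Subgroup.zpowers u).Normal ∧ orderOf a = 2 ^ (5 - 1) ∧
            a ∈ (S : Subgroup (K ≃ₐ[ℚ] K)) ∧ x ∈ (S : Subgroup (K ≃ₐ[ℚ] K)) ∧ x ∉ Subgroup.zpowers a ∧ x * a = a⁻¹ * x ∧
            x * x = a ^ 2 ^ (5 - 2) ∧ (∀ g : K ≃ₐ[ℚ] K, ∃ j i : ℕ, g = u ^ j * a ^ i ∨ g = u ^ j * (x * a ^ i)) ∧
            ((a * u * a⁻¹ = u ∧ x * u * x⁻¹ = u) ∨ (a * u * a⁻¹ = u ∧ x * u * x⁻¹ = u⁻¹) ∨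
              (a * u * a⁻¹ = u⁻¹ ∧ x * u * x⁻¹ = u)))) := by
  classical
  have hdeg' : Module.finrank ℚ K = 2 ^ 5 * p := by rw [hdeg]; norm_num
  obtain ⟨P, hPn, hcardP⟩ := exists_normal_prime_thirtytwo_mul_prime hp2 hdeg hgood
  haveI := hPn
  obtain ⟨hcardS, hS⟩ := sylow_two_isCyclic_or_quaternion_of_normal_prime hp2 hdeg' le_rfl P hcardP hgood S
  refine ⟨hcardS, ?_⟩
  rcases hS with hcyc | ⟨⟨f⟩⟩
  · exact Or.inl ⟨hcyc, (shape_of_isCyclic_sylow_of_normal_prime hp2 hdeg' le_rfl P hcardP hgood S hcyc).2⟩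
  · exact Or.inr ⟨⟨f⟩, (shape_of_quaternion_sylow_of_normal_prime hp2 hdeg' le_rfl P hcardP hgood S f).2⟩

/-! ## §3 BAD corollaries at degree `32·p` -/

/-- **Degree `32·p` (`p` an odd prime) and an involution `σ ≠ c` of `Gal(K/ℚ)` ⟹ BAD**: `K` carries a SIMPLE DEGENERATE abelian variety
of dimension `16p` with a rational `(q,q)` class outside the divisor ring on some power. [cite: Shimura1998, §6.2 Thm. 3 and §8.2 Prop. 26]
[cite: Gordon1999HodgeAVSurvey, Thm. 6.4 and §9.3] [cite: Dodson1984, §5] -/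
theorem exists_simple_degenerate_of_involution_ne_thirtytwo_mul_prime {p : ℕ} (hp : p.Prime) (hp2 : p ≠ 2)
    (hdeg : Module.finrank ℚ K = 32 * p) (σ : K ≃ₐ[ℚ] K) (hσσ : σ * σ = 1) (hσ1 : σ ≠ 1)
    (hσc : σ ≠ (IsCMField.complexConj K).restrictScalars ℚ) :
    ∃ (Φ : CMType K) (φ : K →+* ℂ) (X : AbelianVariety ℂ) (ι : 𝓞 K →+* End X)
      (ϑ : K →+* Module.End ℂ (complexBetti X.X 1)),
      IsPrimitive (ℂ ≃+* ℂ) Φ.1 φ ∧ ¬ IsNondegenerate Φ ∧ IsCMTypeRealisation Φ X ι ϑ ∧ X.IsSimple ∧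
      X.dim = Module.finrank ℚ K / 2 ∧
      ∃ n p : ℕ, ∃ x : complexBetti (⨁ fun _ : Fin n => X).X (2 * p), IsRationalClass x ∧
        IsOfHodgeType (⨁ fun _ : Fin n => X).dim (⨁ fun _ : Fin n => X).X (2 * p) p p x ∧
        x ∉ divisorClassesSpan (⨁ fun _ : Fin n => X).X (⨁ fun _ : Fin n => X).dim p :=
  haveI : Fact p.Prime := ⟨hp⟩
  exists_simple_degenerate_of_not_forall_isNondegenerate fun hgood =>
    hσc (involution_eq_complexConj_thirtytwo_mul_prime hp2 hdeg hgood σ hσσ hσ1)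

/-- **Degree `32·p` (`p` an odd prime) and a Sylow `2`-subgroup which is neither cyclic nor `≅ Q₃₂` ⟹ BAD.**
[cite: Shimura1998, §6.2 Thm. 3 and §8.2 Prop. 26] [cite: Gordon1999HodgeAVSurvey, Thm. 6.4 and §9.3] [cite: Rotman1995, Thm. 5.46] -/
theorem exists_simple_degenerate_of_sylow_two_thirtytwo_mul_prime {p : ℕ} (hp : p.Prime) (hp2 : p ≠ 2)
    (hdeg : Module.finrank ℚ K = 32 * p) [Fact (Nat.Prime 2)] (S : Sylow 2 (K ≃ₐ[ℚ] K))
    (hS : ¬ IsCyclic (S : Subgroup (K ≃ₐ[ℚ] K))) (hS' : IsEmpty ((S : Subgroup (K ≃ₐ[ℚ] K)) ≃* QuaternionGroup (2 ^ (5 - 2)))) :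
    ∃ (Φ : CMType K) (φ : K →+* ℂ) (X : AbelianVariety ℂ) (ι : 𝓞 K →+* End X)
      (ϑ : K →+* Module.End ℂ (complexBetti X.X 1)),
      IsPrimitive (ℂ ≃+* ℂ) Φ.1 φ ∧ ¬ IsNondegenerate Φ ∧ IsCMTypeRealisation Φ X ι ϑ ∧ X.IsSimple ∧
      X.dim = Module.finrank ℚ K / 2 ∧
      ∃ n p : ℕ, ∃ x : complexBetti (⨁ fun _ : Fin n => X).X (2 * p), IsRationalClass x ∧
        IsOfHodgeType (⨁ fun _ : Fin n => X).dim (⨁ fun _ : Fin n => X).X (2 * p) p p x ∧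
        x ∉ divisorClassesSpan (⨁ fun _ : Fin n => X).X (⨁ fun _ : Fin n => X).dim p :=
  haveI : Fact p.Prime := ⟨hp⟩
  exists_simple_degenerate_of_not_forall_isNondegenerate fun hgood => by
    rcases (sylow_two_isCyclic_or_quaternion_thirtytwo_mul_prime hp2 hdeg hgood S).2 with h | ⟨⟨f⟩⟩
    · exact hS h
    · exact hS'.false f

/-- **Degree `32·p` (`p` an odd prime) and a NON-NORMAL Sylow `p`-subgroup ⟹ BAD** (e.g. `Gal ≅ (C₂⁴ ⋊ C₅) × C₂` of order `160`, or
`(C₂³ ⋊ C₇) × C₄` of order `224`). [cite: Shimura1998, §6.2 Thm. 3 and §8.2 Prop. 26] [cite: Gordon1999HodgeAVSurvey, Thm. 6.4 and §9.3]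
[cite: Rotman1995, Thm. 4.12] -/
theorem exists_simple_degenerate_of_sylow_not_normal_thirtytwo_mul_prime {p : ℕ} (hp : p.Prime) (hp2 : p ≠ 2)
    (hdeg : Module.finrank ℚ K = 32 * p) (Q : @Sylow p (K ≃ₐ[ℚ] K) _) (hQ : ¬ (Q : Subgroup (K ≃ₐ[ℚ] K)).Normal) :
    ∃ (Φ : CMType K) (φ : K →+* ℂ) (X : AbelianVariety ℂ) (ι : 𝓞 K →+* End X)
      (ϑ : K →+* Module.End ℂ (complexBetti X.X 1)),
      IsPrimitive (ℂ ≃+* ℂ) Φ.1 φ ∧ ¬ IsNondegenerate Φ ∧ IsCMTypeRealisation Φ X ι ϑ ∧ X.IsSimple ∧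
      X.dim = Module.finrank ℚ K / 2 ∧
      ∃ n p : ℕ, ∃ x : complexBetti (⨁ fun _ : Fin n => X).X (2 * p), IsRationalClass x ∧
        IsOfHodgeType (⨁ fun _ : Fin n => X).dim (⨁ fun _ : Fin n => X).X (2 * p) p p x ∧
        x ∉ divisorClassesSpan (⨁ fun _ : Fin n => X).X (⨁ fun _ : Fin n => X).dim p :=
  haveI : Fact p.Prime := ⟨hp⟩
  exists_simple_degenerate_of_not_forall_isNondegenerate fun hgood => hQ (sylow_normal_thirtytwo_mul_prime hp2 hdeg hgood Q)

end Summit.HodgeConjecture.CorCM.GaloisModels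

end
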